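import Summits.HodgeConjecture.HodgeConjecture.Theorems.F0P3bKTypeIntegrationGK
import Summits.HodgeConjecture.HodgeConjecture.Theorems.F0P3bU21Restriction
import Literature.RepresentationTheory.Kovacevic2021.SU21ModulesFromKTypes
import HarnessLib

/-!
# W1 · `K`-integration of Kovačević's ladder module `Z(3) = ladderPlus` (stub `StubW1KIntegration` of `F0_LocalAPackets`)

Route `F0_ThetaPinDelta`, line `Cruxes/H413/Lines/F0_LocalAPackets.lean` (crux item H413), stub `StubT3aRealisationDatum`, waypoint
**W1** = registered stub `StubW1KIntegration` (edition 4K, commit f122f152d1ee, :200):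
`IsGKModule G21 (kTypeRep ladderPlus.S) (kovLie ladderPlus.ρ)` — closed here by `stubW1KIntegration_holds` (statement VERBATIM; this file
never imports `Lines`).
Lead A-p03 (g18), pen F0P3b-plan (g5).  Namespace `Summit.HodgeConjecture.HodgeConjecture.Cruxes.H413.F0P3bStubW1KIntegration`.
PROOF lane (theorems only).

This is FILE B of W1 — the Kovačević-DEPENDENT glue (imports ★ `Kovacevic2021.SU21ModulesFromKTypes`): the `(𝔤, K)`-module structure is
★ `F0P3bKTypeIntegrationGK.exists_isGKModule_of_kovacevicForm` (Kovačević-free FILE A) applied to `S := ladderPlus.S` — the carrier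
`KIdx ladderPlus.S →₀ ℂ` IS `ladderPlus.V` (both sides `abbrev`), `kvec ladderPlus.S = ladderPlus.vec` definitionally, the eight-operator
decomposition of `kovLie ladderPlus.ρ X` is `SU21Datum.ρfun` (definitional, via ★ `F0P3bU21Restriction.kovLie_apply`), and the four
`𝔨`-formulas are ★ `SU21Datum.Ha_vec ∕ Hb_vec ∕ Xa_vec ∕ Ya_vec`.  The labels of `ladderPlus` are `(n, 3n − 3)`, `n ≥ 2` (★ `mem_ladderPlus`),
so `6 ∣ m − 3n + 3 = 0`: the `K`-types are `u^{1−n} ⊗ Sym^{n−1}` (`a = 0`, `b = 1 − n`).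

HONEST LABEL: HC_CM is proved only modulo the printed citations until rung 0 closes; this closes one waypoint (W1) of one engine stub (T3a₁).

[cite: BorelWallach2000, 0 §2.5] [cite: Kovacevic2021, §3 Def. 1, Thm. 1; §4 Thm. 5 (`Z(s)`)]
-/

noncomputable section

namespace Summit.HodgeConjecture.HodgeConjecture.Cruxes.H413.F0P3bStubW1KIntegration

open Literature.NumberTheory.Automorphic
open Literature.RepresentationTheory.BorelWallach2000
open Literature.RepresentationTheory.KonnoKonno2007 Literature.RepresentationTheory.KonnoKonno2007.RealDualPair
open Literature.RepresentationTheory.KonnoKonno2007.RealDualPair.UForm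
open Literature.RepresentationTheory.Kovacevic2021
open Summit.HodgeConjecture.HodgeConjecture.Cruxes.H413.F0P3bLocalAPacketsDefs
open Summit.HodgeConjecture.HodgeConjecture.Cruxes.H413.F0P3bU21Restriction
open Summit.HodgeConjecture.HodgeConjecture.Cruxes.H413.F0P3bKTypeIntegration
open Summit.HodgeConjecture.HodgeConjecture.Cruxes.H413.F0P3bKTypeIntegrationGK

-- Mathlib idiom (as in `GKModules`, the `Upq*` files, the defs leaf and the line): commutator bracket on `Module.End`
attribute [local instance 100] LieRing.ofAssociativeRing

set_option autoImplicit false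
set_option linter.dupNamespace false

/-- The `K`-type labels of `Z(3) = ladderPlus` are `(n, 3n − 3)` with `n ≥ 2` (★ `mem_ladderPlus`); in particular `1 ≤ n` and
`6 ∣ m − 3n + 3` (`= 0`). [cite: Kovacevic2021, §4 Thm. 5] -/
theorem ladderPlus_labels (n m : ℤ) (h : (n, m) ∈ SU21Datum.ladderPlus.S) : 1 ≤ n ∧ (6 : ℤ) ∣ m - 3 * n + 3 := by
  rw [SU21Datum.mem_ladderPlus] at h
  obtain ⟨hn, hm⟩ := h
  exact ⟨by omega, ⟨0, by rw [hm]; ring⟩⟩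

/-- The datum-free basis vectors of FILE A are Kovačević's: `kvec 𝒟.S n m k = 𝒟.vec n m k` (same body). [cite: Kovacevic2021, §3 Def. 1] -/
theorem kvec_eq_vec (𝒟 : SU21Datum) (n m k : ℤ) : kvec 𝒟.S n m k = 𝒟.vec n m k := rfl

/-- On `𝔨`, `kovLie 𝒟.ρ X` is Kovačević's eight-operator combination `ρfun` of the reindexed matrix (definitional:
★ `kovLie_apply`, `ρ_apply`). [cite: Kovacevic2021, §3] -/
theorem kovLie_inclusion_eq (𝒟 : SU21Datum) (X : (uFormGroup (Fin 2) (Fin 1)).compactLie) :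
    kovLie 𝒟.ρ (LieSubalgebra.inclusion (uFormGroup (Fin 2) (Fin 1)).compactLie_le_lie X) =
      ((2 * Matrix.reindex (finSumFinEquiv : Fin 2 ⊕ Fin 1 ≃ Fin 3) (finSumFinEquiv : Fin 2 ⊕ Fin 1 ≃ Fin 3)
              (X : Matrix (Fin 2 ⊕ Fin 1) (Fin 2 ⊕ Fin 1) ℂ) 0 0
            - Matrix.reindex (finSumFinEquiv : Fin 2 ⊕ Fin 1 ≃ Fin 3) (finSumFinEquiv : Fin 2 ⊕ Fin 1 ≃ Fin 3)
              (X : Matrix (Fin 2 ⊕ Fin 1) (Fin 2 ⊕ Fin 1) ℂ) 1 1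
            - Matrix.reindex (finSumFinEquiv : Fin 2 ⊕ Fin 1 ≃ Fin 3) (finSumFinEquiv : Fin 2 ⊕ Fin 1 ≃ Fin 3)
              (X : Matrix (Fin 2 ⊕ Fin 1) (Fin 2 ⊕ Fin 1) ℂ) 2 2) / 3) • 𝒟.Ha
      + ((Matrix.reindex (finSumFinEquiv : Fin 2 ⊕ Fin 1 ≃ Fin 3) (finSumFinEquiv : Fin 2 ⊕ Fin 1 ≃ Fin 3)
              (X : Matrix (Fin 2 ⊕ Fin 1) (Fin 2 ⊕ Fin 1) ℂ) 0 0
            + Matrix.reindex (finSumFinEquiv : Fin 2 ⊕ Fin 1 ≃ Fin 3) (finSumFinEquiv : Fin 2 ⊕ Fin 1 ≃ Fin 3)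
              (X : Matrix (Fin 2 ⊕ Fin 1) (Fin 2 ⊕ Fin 1) ℂ) 1 1
            - 2 * Matrix.reindex (finSumFinEquiv : Fin 2 ⊕ Fin 1 ≃ Fin 3) (finSumFinEquiv : Fin 2 ⊕ Fin 1 ≃ Fin 3)
              (X : Matrix (Fin 2 ⊕ Fin 1) (Fin 2 ⊕ Fin 1) ℂ) 2 2) / 3) • 𝒟.Hb
      + Matrix.reindex (finSumFinEquiv : Fin 2 ⊕ Fin 1 ≃ Fin 3) (finSumFinEquiv : Fin 2 ⊕ Fin 1 ≃ Fin 3)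
          (X : Matrix (Fin 2 ⊕ Fin 1) (Fin 2 ⊕ Fin 1) ℂ) 0 1 • 𝒟.Xa
      + Matrix.reindex (finSumFinEquiv : Fin 2 ⊕ Fin 1 ≃ Fin 3) (finSumFinEquiv : Fin 2 ⊕ Fin 1 ≃ Fin 3)
          (X : Matrix (Fin 2 ⊕ Fin 1) (Fin 2 ⊕ Fin 1) ℂ) 1 0 • 𝒟.Ya
      + Matrix.reindex (finSumFinEquiv : Fin 2 ⊕ Fin 1 ≃ Fin 3) (finSumFinEquiv : Fin 2 ⊕ Fin 1 ≃ Fin 3)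
          (X : Matrix (Fin 2 ⊕ Fin 1) (Fin 2 ⊕ Fin 1) ℂ) 1 2 • 𝒟.Xb
      + Matrix.reindex (finSumFinEquiv : Fin 2 ⊕ Fin 1 ≃ Fin 3) (finSumFinEquiv : Fin 2 ⊕ Fin 1 ≃ Fin 3)
          (X : Matrix (Fin 2 ⊕ Fin 1) (Fin 2 ⊕ Fin 1) ℂ) 2 1 • 𝒟.Yb
      + Matrix.reindex (finSumFinEquiv : Fin 2 ⊕ Fin 1 ≃ Fin 3) (finSumFinEquiv : Fin 2 ⊕ Fin 1 ≃ Fin 3)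
          (X : Matrix (Fin 2 ⊕ Fin 1) (Fin 2 ⊕ Fin 1) ℂ) 0 2 • 𝒟.Xab
      + Matrix.reindex (finSumFinEquiv : Fin 2 ⊕ Fin 1 ≃ Fin 3) (finSumFinEquiv : Fin 2 ⊕ Fin 1 ≃ Fin 3)
          (X : Matrix (Fin 2 ⊕ Fin 1) (Fin 2 ⊕ Fin 1) ℂ) 2 0 • 𝒟.Yab := by
  rw [kovLie_apply, SU21Datum.ρ_apply]
  rfl

/-- **Kovačević's `𝔲(2,1)`-action restricted to `𝔨` acts on the `u`-basis by his formulas** (`ActsOnKTypes`, the interface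
predicate of FILE A): `ρfun` on block-diagonal matrices + ★ `Ha_vec ∕ Hb_vec ∕ Xa_vec ∕ Ya_vec`. [cite: Kovacevic2021, §3 Def. 1, Thm. 1] -/
theorem actsOnKTypes_kovLie (𝒟 : SU21Datum) : ActsOnKTypes 𝒟.S (kovLie 𝒟.ρ) :=
  actsOnKTypes_of_kovacevicForm (S := 𝒟.S) (kovLie 𝒟.ρ) 𝒟.Ha 𝒟.Hb 𝒟.Xa 𝒟.Ya 𝒟.Xb 𝒟.Yb 𝒟.Xab 𝒟.Yab
    (kovLie_inclusion_eq 𝒟)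
    (fun n m k => by simp only [kvec_eq_vec]; exact SU21Datum.Ha_vec n m k)
    (fun n m k => by simp only [kvec_eq_vec]; exact SU21Datum.Hb_vec n m k)
    (fun n m k => by simp only [kvec_eq_vec]; exact SU21Datum.Xa_vec n m k)
    (fun n m _ hk => by simp only [kvec_eq_vec]; exact SU21Datum.Ya_vec n m hk)

/-- **W1 for ANY Kovačević datum with `6 ∣ m − 3n + 3` on its labels, with the EXPLICIT `K`-action**:
`(kTypeRep 𝒟.S, kovLie 𝒟.ρ)` is a `(𝔤, K)`-module of `U(2,1)` (`kTypeRep` = `det^a ⊗ u^b ⊗ Sym^{n−1}` on `V_{n,m}` in the `u`-basis,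
`a = (m − 3n + 3)/6`, `b = −m/3`). [cite: BorelWallach2000, 0 §2.5] [cite: Kovacevic2021, §3 Def. 1, Thm. 1] -/
theorem isGKModule_kTypeRep_kovLie (𝒟 : SU21Datum) (hS : ∀ n m : ℤ, (n, m) ∈ 𝒟.S → 1 ≤ n ∧ (6 : ℤ) ∣ m - 3 * n + 3) :
    IsGKModule G21 (kTypeRep 𝒟.S) (kovLie 𝒟.ρ) :=
  isGKModule_kTypeRep hS (kovLie 𝒟.ρ) (actsOnKTypes_kovLie 𝒟)

/-- **W1 · `K`-INTEGRATION OF `Z(3) = ladderPlus`** — the registered stub `StubW1KIntegration` of `Cruxes/H413/Lines/F0_LocalAPackets.lean`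
(edition 4K, :200) VERBATIM: `(kTypeRep ladderPlus.S, kovLie ladderPlus.ρ)` is a `(𝔤, K)`-module of `U(2,1)` (`K`-types `u^{1−n} ⊗ Sym^{n−1}`).
The line folds `theorem stub_W1KIntegration : StubW1KIntegration := stubW1KIntegration_holds`. [cite: BorelWallach2000, 0 §2.5] [cite: Kovacevic2021, §4 Thm. 5] -/
theorem stubW1KIntegration_holds :
    IsGKModule G21 (kTypeRep SU21Datum.ladderPlus.S) (kovLie SU21Datum.ladderPlus.ρ) :=
  isGKModule_kTypeRep_kovLie SU21Datum.ladderPlus ladderPlus_labels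

/-- The existential form (edition 4 of the line, before the planner's «concrete» ruling): SOME compatible `K`-action exists on `ladderPlus.V`.
[cite: BorelWallach2000, 0 §2.5] [cite: Kovacevic2021, §4 Thm. 5] -/
theorem exists_isGKModule_ladderPlus :
    ∃ ρK : Representation ℂ G21.maximalCompact SU21Datum.ladderPlus.V, IsGKModule G21 ρK (kovLie SU21Datum.ladderPlus.ρ) :=
  ⟨kTypeRep SU21Datum.ladderPlus.S, stubW1KIntegration_holds⟩

end Summit.HodgeConjecture.HodgeConjecture.Cruxes.H413.F0P3bStubW1KIntegration

end
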